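import Mathlib.Analysis.SpecialFunctions.Exponential
import Mathlib.Analysis.Complex.Exponential
import Mathlib.Analysis.Asymptotics.Lemmas
import Literature.Analysis.FunctionSpaces.ContDiffHolderComposition
import HarnessLib

/-!
# The exponential nonlinearity is `C¹` on `C^{k,r}_b` (Hölder spaces, part 8)

Topic `Literature/Analysis/FunctionSpaces`. On the Banach space `C^{k,r}_b(E, ℝ)` of part 3
(`ContDiffHolderFunction E ℝ k r`, `0 ≤ r ≤ 1`) the superposition map `u ↦ e^{a u}` (`expMul`, part 6)
is continuously Fréchet differentiable, with derivative `h ↦ a e^{a u} h`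
(`ContDiffHolderFunction.hasFDerivAt_expMul`, `contDiff_one_expMul`, `hasStrictFDerivAt_expMul`).

Proof (the exponential series in the quasi-normed algebra `C^{k,r}_b`, `‖fg‖ ≤ C_k‖f‖‖g‖`,
`C_k = (k+1)9ᵏ`, part 5): the powers `h^{n+1}` satisfy `‖h^{n+1}‖ ≤ C_kⁿ‖h‖^{n+1}`, so the tail
`R(h) = Σ_{n ≥ 2} aⁿhⁿ/n!` converges in `C^{k,r}_b` with `‖R(h)‖ ≤ e^t − 1 − t ≤ t²`,
`t = C_k|a|‖h‖ ≤ 1`; evaluating pointwise (evaluation is a continuous linear functional)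
identifies `e^{a h} = 1 + a h + R(h)` in `C^{k,r}_b`; hence
`e^{a(u+h)} − e^{a u} − a e^{a u} h = e^{a u} R(h) = O(‖h‖²)`. Continuity of the derivative
`u ↦ a · mul(e^{a u}, ·)` follows from the continuity of `u ↦ e^{a u}` and of the multiplication,
and strict differentiability from `C¹`.

This is the Nemytskii step for the only non-polynomial nonlinearity `q e^{−4w}` of the weighted
`σ₂` path equation read on the background
(`Literature.Geometry.Riemannian.GurskyViaclovskyPath.backgroundPathOperator`; brick (1e-b) of the
census of `Literature.Geometry.Riemannian.gurskyViaclovsky_pathOpen_weighted_four`). Everything is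
proved; no named facts.

## References

* D. Gilbarg, N. S. Trudinger, *Elliptic Partial Differential Equations of Second Order* (2001),
  §4.1, Ch. 17. [GilbargTrudinger2001]
-/

noncomputable section

open Set Filter Metric Asymptotics Topology
open scoped NNReal ENNReal Nat

namespace Literature.Analysis.FunctionSpaces

/-! ### Constants -/

section Const

variable {E F : Type*} [NormedAddCommGroup E] [NormedSpace ℝ E] [NormedAddCommGroup F]
  [NormedSpace ℝ F] {k : ℕ} {r : ℝ≥0}

/-- Constant maps are in `C^{k,r}_b`. [folklore] -/
theorem memContDiffHolder_const (c : F) : MemContDiffHolder k r (fun _ : E => c) := by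
  have hval : ∀ (j : ℕ) (x y : E),
      iteratedFDeriv ℝ j (fun _ : E => c) x = iteratedFDeriv ℝ j (fun _ : E => c) y := by
    intro j x y
    rcases Nat.eq_zero_or_pos j with rfl | hj
    · ext m
      simp
    · rw [iteratedFDeriv_const_of_ne (Nat.pos_iff_ne_zero.1 hj)]
      rfl
  refine ⟨contDiff_const, fun j _ => ?_, ⟨0, fun x y => ?_⟩⟩
  · refine eSupNorm_lt_top_iff.2 ⟨‖c‖, fun x => ?_⟩
    rcases Nat.eq_zero_or_pos j with rfl | hj
    · rw [norm_iteratedFDeriv_zero]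
    · rw [iteratedFDeriv_const_of_ne (Nat.pos_iff_ne_zero.1 hj)]
      simp
  · rw [hval k x y, edist_self]
    exact bot_le

namespace ContDiffHolderFunction

/-- The constant map as an element of `C^{k,r}_b`. [folklore] -/
def const (c : F) : ContDiffHolderFunction E F k r :=
  ⟨fun _ => c, memContDiffHolder_const c⟩

/-- Pointwise: `const c x = c`. [folklore] -/
@[simp]
theorem const_apply (c : F) (x : E) : (const c : ContDiffHolderFunction E F k r) x = c := rfl

end ContDiffHolderFunction

end Const

/-! ### Powers and the exponential series in `C^{k,r}_b(E, ℝ)` -/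

section Exp

variable {E : Type} [NormedAddCommGroup E] [NormedSpace ℝ E] {k : ℕ} {r : ℝ≥0}

namespace ContDiffHolderFunction

/-- The algebra constant `C_k = (k+1)9ᵏ` of part 5 (`‖fg‖ ≤ C_k‖f‖‖g‖`). [folklore] -/
def algConst (k : ℕ) : ℝ := (k + 1) * 9 ^ k

/-- `1 ≤ C_k`. [folklore] -/
theorem one_le_algConst (k : ℕ) : 1 ≤ algConst k := by
  unfold algConst
  have h1 : (1 : ℝ) ≤ k + 1 := by
    have : (0 : ℝ) ≤ k := Nat.cast_nonneg k
    linarith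
  have h2 : (1 : ℝ) ≤ 9 ^ k := one_le_pow₀ (by norm_num)
  nlinarith

/-- `0 ≤ C_k`. [folklore] -/
theorem algConst_nonneg (k : ℕ) : 0 ≤ algConst k :=
  zero_le_one.trans (one_le_algConst k)

/-- The powers `h^{n+1}` in `C^{k,r}_b(E, ℝ)`: `powSucc hr h n = h^{n+1}`. [folklore] -/
def powSucc (hr : r ≤ 1) (h : ContDiffHolderFunction E ℝ k r) : ℕ → ContDiffHolderFunction E ℝ k r
  | 0 => h
  | n + 1 => mul hr (powSucc hr h n) h

/-- Pointwise: `powSucc hr h n x = (h x)^(n+1)`. [folklore] -/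
@[simp]
theorem powSucc_apply (hr : r ≤ 1) (h : ContDiffHolderFunction E ℝ k r) (n : ℕ) (x : E) :
    powSucc hr h n x = h x ^ (n + 1) := by
  induction n with
  | zero => simp [powSucc]
  | succ n ih => simp [powSucc, ih, pow_succ]

/-- `‖h^{n+1}‖ ≤ C_kⁿ ‖h‖^{n+1}`. [folklore] -/
theorem norm_powSucc_le (hr : r ≤ 1) (h : ContDiffHolderFunction E ℝ k r) (n : ℕ) :
    ‖powSucc hr h n‖ ≤ algConst k ^ n * ‖h‖ ^ (n + 1) := by
  induction n with
  | zero => simp [powSucc]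
  | succ n ih =>
    calc ‖powSucc hr h (n + 1)‖ = ‖mul hr (powSucc hr h n) h‖ := rfl
      _ ≤ algConst k * ‖powSucc hr h n‖ * ‖h‖ := norm_mul_le hr _ _
      _ ≤ algConst k * (algConst k ^ n * ‖h‖ ^ (n + 1)) * ‖h‖ := by
          gcongr
          exact algConst_nonneg k
      _ = algConst k ^ (n + 1) * ‖h‖ ^ (n + 1 + 1) := by ring

/-- The terms of the exponential tail: `expTerm a h n = (a^{n+2}/(n+2)!) h^{n+2}`. [folklore] -/
def expTerm (hr : r ≤ 1) (a : ℝ) (h : ContDiffHolderFunction E ℝ k r) (n : ℕ) :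
    ContDiffHolderFunction E ℝ k r :=
  (a ^ (n + 2) / (n + 2)!) • powSucc hr h (n + 1)

/-- Pointwise: `expTerm hr a h n x = (a h x)^{n+2}/(n+2)!`. [folklore] -/
theorem expTerm_apply (hr : r ≤ 1) (a : ℝ) (h : ContDiffHolderFunction E ℝ k r) (n : ℕ) (x : E) :
    expTerm hr a h n x = (a * h x) ^ (n + 2) / (n + 2)! := by
  simp only [expTerm, coe_smul, Pi.smul_apply, powSucc_apply, smul_eq_mul]
  rw [mul_pow]
  ring

/-- Norm of the terms: `‖expTerm n‖ ≤ t^{n+2}/(n+2)!`, `t = C_k |a| ‖h‖`. [folklore] -/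
theorem norm_expTerm_le (hr : r ≤ 1) (a : ℝ) (h : ContDiffHolderFunction E ℝ k r) (n : ℕ) :
    ‖expTerm hr a h n‖ ≤ (algConst k * |a| * ‖h‖) ^ (n + 2) / (n + 2)! := by
  unfold expTerm
  rw [norm_smul, Real.norm_eq_abs, abs_div, abs_pow, Nat.abs_cast]
  have hC := algConst_nonneg k
  have h1 : ‖powSucc hr h (n + 1)‖ ≤ algConst k ^ (n + 1) * ‖h‖ ^ (n + 2) :=
    norm_powSucc_le hr h (n + 1)
  have h2 : algConst k ^ (n + 1) ≤ algConst k ^ (n + 2) :=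
    pow_le_pow_right₀ (one_le_algConst k) (Nat.le_succ _)
  have hfact : (0 : ℝ) < (n + 2)! := by positivity
  calc |a| ^ (n + 2) / ((n + 2)! : ℝ) * ‖powSucc hr h (n + 1)‖
      ≤ |a| ^ (n + 2) / ((n + 2)! : ℝ) * (algConst k ^ (n + 2) * ‖h‖ ^ (n + 2)) := by
        refine mul_le_mul_of_nonneg_left (h1.trans ?_) (by positivity)
        exact mul_le_mul_of_nonneg_right h2 (by positivity)
    _ = (algConst k * |a| * ‖h‖) ^ (n + 2) / (n + 2)! := by
        rw [mul_pow, mul_pow]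
        field_simp

/-- **The exponential tail converges in `C^{k,r}_b`**, with sum of norm at most `e^t − 1 − t`,
`t = C_k |a| ‖h‖`. [folklore] -/
theorem summable_expTerm (hr : r ≤ 1) (a : ℝ) (h : ContDiffHolderFunction E ℝ k r) :
    Summable (expTerm hr a h) := by
  refine Summable.of_norm_bounded (g := fun n => (algConst k * |a| * ‖h‖) ^ (n + 2) / (n + 2)!)
    ?_ (norm_expTerm_le hr a h)
  exact (summable_nat_add_iff 2).2 (Real.summable_pow_div_factorial _)

/-- The real exponential tail: `Σ_n t^{n+2}/(n+2)! = e^t − 1 − t`. [folklore] -/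
theorem hasSum_exp_tail (t : ℝ) :
    HasSum (fun n : ℕ => t ^ (n + 2) / (n + 2)!) (Real.exp t - 1 - t) := by
  have h := NormedSpace.expSeries_div_hasSum_exp t
  rw [← congrFun Real.exp_eq_exp_ℝ t] at h
  have h2 := (hasSum_nat_add_iff' (f := fun n : ℕ => t ^ n / n !) 2).2 h
  simp only [Finset.sum_range_succ, Finset.sum_range_zero, pow_zero, Nat.factorial_zero,
    Nat.cast_one, div_one, zero_add, pow_one, Nat.factorial_one] at h2
  rw [show Real.exp t - 1 - t = Real.exp t - (1 + t) by ring]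
  exact h2

/-- **The exponential tail** `expTail hr a h = Σ_{n ≥ 2} aⁿhⁿ/n!` in `C^{k,r}_b(E, ℝ)`. [folklore] -/
def expTail (hr : r ≤ 1) (a : ℝ) (h : ContDiffHolderFunction E ℝ k r) :
    ContDiffHolderFunction E ℝ k r :=
  ∑' n, expTerm hr a h n

/-- `‖expTail‖ ≤ e^t − 1 − t`, `t = C_k |a| ‖h‖`. [folklore] -/
theorem norm_expTail_le (hr : r ≤ 1) (a : ℝ) (h : ContDiffHolderFunction E ℝ k r) :
    ‖expTail hr a h‖ ≤ Real.exp (algConst k * |a| * ‖h‖) - 1 - algConst k * |a| * ‖h‖ :=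
  (summable_expTerm hr a h).hasSum.norm_le_of_bounded (hasSum_exp_tail _) (norm_expTerm_le hr a h)

/-- `‖expTail‖ ≤ t²` for `t = C_k |a| ‖h‖ ≤ 1`. [folklore] -/
theorem norm_expTail_le_sq (hr : r ≤ 1) (a : ℝ) (h : ContDiffHolderFunction E ℝ k r)
    (ht : algConst k * |a| * ‖h‖ ≤ 1) :
    ‖expTail hr a h‖ ≤ (algConst k * |a| * ‖h‖) ^ 2 := by
  have ht0 : 0 ≤ algConst k * |a| * ‖h‖ := by
    have := algConst_nonneg k
    positivity
  refine (norm_expTail_le hr a h).trans ?_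
  have h1 := Real.abs_exp_sub_one_sub_id_le (x := algConst k * |a| * ‖h‖)
    (by rwa [abs_of_nonneg ht0])
  exact (le_abs_self _).trans h1

/-- Pointwise: `expTail hr a h x = e^{a h x} − 1 − a h x`. [folklore] -/
theorem expTail_apply (hr : r ≤ 1) (a : ℝ) (h : ContDiffHolderFunction E ℝ k r) (x : E) :
    expTail hr a h x = Real.exp (a * h x) - 1 - a * h x := by
  have h1 : HasSum (fun n => expTerm hr a h n x) (expTail hr a h x) := by
    have := ((summable_expTerm hr a h).hasSum).mapL (evalCLM x)
    simpa [evalCLM, expTail] using this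
  have h2 : HasSum (fun n => expTerm hr a h n x) (Real.exp (a * h x) - 1 - a * h x) := by
    simp only [expTerm_apply]
    exact hasSum_exp_tail _
  exact h1.unique h2

/-- **The exponential in `C^{k,r}_b` is its series**: `e^{a h} = 1 + a h + expTail`. [folklore] -/
theorem expMul_eq_add_expTail (hr : r ≤ 1) (a : ℝ) (h : ContDiffHolderFunction E ℝ k r) :
    expMul hr a h = const 1 + a • h + expTail hr a h :=
  ContDiffHolderFunction.ext fun x => by
    simp only [expMul_apply, coe_add, Pi.add_apply, const_apply, coe_smul, Pi.smul_apply,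
      smul_eq_mul, expTail_apply]
    ring

/-! ### Differentiability -/

/-- Left multiplication by `c ∈ C^{k,r}_b(E, ℝ)` as a continuous linear map. [folklore] -/
def mulLeftCLM (hr : r ≤ 1) (c : ContDiffHolderFunction E ℝ k r) :
    ContDiffHolderFunction E ℝ k r →L[ℝ] ContDiffHolderFunction E ℝ k r :=
  bilinearCLM hr (ContinuousLinearMap.mul ℝ ℝ) c

/-- `mulLeftCLM hr c g = mul hr c g`. [folklore] -/
@[simp]
theorem mulLeftCLM_apply (hr : r ≤ 1) (c g : ContDiffHolderFunction E ℝ k r) :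
    mulLeftCLM hr c g = mul hr c g := rfl

/-- The functional equation, pointwise form: `e^{a(u+h)} − e^{au} − a e^{au} h = e^{au}·expTail(h)`.
[folklore] -/
theorem expMul_add_sub_eq (hr : r ≤ 1) (a : ℝ) (u h : ContDiffHolderFunction E ℝ k r) :
    expMul hr a (u + h) - expMul hr a u - (a • mulLeftCLM hr (expMul hr a u)) h =
      mul hr (expMul hr a u) (expTail hr a h) :=
  ContDiffHolderFunction.ext fun x => by
    simp only [coe_sub, Pi.sub_apply, expMul_apply, coe_add, Pi.add_apply,
      FunLike.coe_smul, Pi.smul_apply, mulLeftCLM_apply, mul_apply, coe_smul,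
      smul_eq_mul, expTail_apply]
    rw [mul_add, Real.exp_add]
    ring

/-- **`u ↦ e^{au}` is Fréchet differentiable on `C^{k,r}_b(E, ℝ)`** with derivative
`h ↦ a e^{au} h`. [cite: GilbargTrudinger2001, §4.1] -/
theorem hasFDerivAt_expMul (hr : r ≤ 1) (a : ℝ) (u : ContDiffHolderFunction E ℝ k r) :
    HasFDerivAt (expMul hr a) (a • mulLeftCLM hr (expMul hr a u)) u := by
  rw [hasFDerivAt_iff_isLittleO_nhds_zero]
  have hC := algConst_nonneg k
  -- `O(‖h‖²)` bound near `0`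
  have hbig : (fun h => expMul hr a (u + h) - expMul hr a u - (a • mulLeftCLM hr (expMul hr a u)) h)
      =O[𝓝 0] fun h => ‖h‖ ^ 2 := by
    refine IsBigO.of_bound (algConst k * ‖expMul hr a u‖ * (algConst k * |a|) ^ 2) ?_
    have hδ : (0 : ℝ) < 1 / (algConst k * |a| + 1) := by positivity
    filter_upwards [Metric.ball_mem_nhds (0 : ContDiffHolderFunction E ℝ k r) hδ] with h hh
    rw [Metric.mem_ball, dist_zero_right] at hh
    have ht : algConst k * |a| * ‖h‖ ≤ 1 := by
      have h1 : algConst k * |a| * ‖h‖ ≤ (algConst k * |a| + 1) * ‖h‖ := by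
        nlinarith [norm_nonneg h, abs_nonneg a]
      have h2 : (algConst k * |a| + 1) * ‖h‖ < 1 := by
        have := (lt_div_iff₀ (by positivity : (0 : ℝ) < algConst k * |a| + 1)).1 hh
        linarith
      linarith
    rw [expMul_add_sub_eq, Real.norm_of_nonneg (by positivity)]
    calc ‖mul hr (expMul hr a u) (expTail hr a h)‖
        ≤ algConst k * ‖expMul hr a u‖ * ‖expTail hr a h‖ := norm_mul_le hr _ _
      _ ≤ algConst k * ‖expMul hr a u‖ * (algConst k * |a| * ‖h‖) ^ 2 := by
          gcongr
          exact norm_expTail_le_sq hr a h ht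
      _ = algConst k * ‖expMul hr a u‖ * (algConst k * |a|) ^ 2 * ‖h‖ ^ 2 := by ring
  exact hbig.trans_isLittleO (isLittleO_norm_pow_id one_lt_two)

/-- `u ↦ e^{au}` is differentiable. [folklore] -/
theorem differentiable_expMul (hr : r ≤ 1) (a : ℝ) :
    Differentiable ℝ (expMul (E := E) (k := k) hr a) := fun u =>
  (hasFDerivAt_expMul hr a u).differentiableAt

/-- `u ↦ e^{au}` is continuous on `C^{k,r}_b(E, ℝ)`. [folklore] -/
theorem continuous_expMul (hr : r ≤ 1) (a : ℝ) : Continuous (expMul (E := E) (k := k) hr a) :=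
  (differentiable_expMul hr a).continuous

/-- The Fréchet derivative of `u ↦ e^{au}`. [folklore] -/
theorem fderiv_expMul (hr : r ≤ 1) (a : ℝ) (u : ContDiffHolderFunction E ℝ k r) :
    fderiv ℝ (expMul hr a) u = a • mulLeftCLM hr (expMul hr a u) :=
  (hasFDerivAt_expMul hr a u).fderiv

/-- **`u ↦ e^{au}` is `C¹` on `C^{k,r}_b(E, ℝ)`**. [cite: GilbargTrudinger2001, §4.1] -/
theorem contDiff_one_expMul (hr : r ≤ 1) (a : ℝ) : ContDiff ℝ 1 (expMul (E := E) (k := k) hr a) := by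
  refine contDiff_one_iff_fderiv.2 ⟨differentiable_expMul hr a, ?_⟩
  have hf : fderiv ℝ (expMul (E := E) (k := k) hr a) =
      fun u => a • (bilinearCLM hr (ContinuousLinearMap.mul ℝ ℝ)) (expMul hr a u) := by
    funext u
    exact fderiv_expMul hr a u
  rw [hf]
  exact ((bilinearCLM hr (ContinuousLinearMap.mul ℝ ℝ) : ContDiffHolderFunction E ℝ k r →L[ℝ]
      ContDiffHolderFunction E ℝ k r →L[ℝ] ContDiffHolderFunction E ℝ k r).continuous.comp
      (continuous_expMul hr a)).const_smul a

/-- **Strict differentiability of `u ↦ e^{au}`** (as needed by the implicit function theorem).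
[folklore] -/
theorem hasStrictFDerivAt_expMul (hr : r ≤ 1) (a : ℝ) (u : ContDiffHolderFunction E ℝ k r) :
    HasStrictFDerivAt (expMul hr a) (a • mulLeftCLM hr (expMul hr a u)) u := by
  have h := ((contDiff_one_expMul (E := E) (k := k) hr a).contDiffAt (x := u)).hasStrictFDerivAt
    one_ne_zero
  rwa [fderiv_expMul] at h

end ContDiffHolderFunction

end Exp

end Literature.Analysis.FunctionSpaces

end
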